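import Literature.NumberTheory.Rogawski1990.UnitaryTwoTypeTwoEdgeCount            -- ★ B2 (the `|2| = 1` original; brings ★ B1, ★ FILE A, ★ B-p10, the place API, `placeForm_antidiagTwo_eq_antidiag`)
import Literature.NumberTheory.Rogawski1990.UnitStableOrbitalIntegralCyclicFrameAffine -- ★ (P5d) p851800: `units_inv_mul_mul_affine_of_affine`
import Literature.NumberTheory.Automorphic.UnitaryTwoIwahoriEdgeCountFibrewiseAffine    -- ★ (P5b) B1′ p851767: `natCard_fixedBy_iwahori_eq_add_mul_of_sub_smul_one_affine`
import Literature.NumberTheory.Automorphic.PlaneLatticesCompanionAffineReductionCount    -- ★ (P5c-IV): `ncard_selfDualStable_affineReduction_antidiag_companion_eq_sum` (`S = Σ_(k<j)`), brings (P5c-II) `…_affine_eq_sum` (`V`)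
import Literature.NumberTheory.Automorphic.SelfDualLatticeCountFrameTransport           -- ★ `ncard_selfDualStable_congr`
import HarnessLib

/-!
# Kottwitz's EDGE COUNT for a type-(2) elliptic element of `U(Φ₂)(L⁺_v)` WITH THE EISENSTEIN CENTRE (any residue characteristic):
# `#Fix_γ(U_w ⧸ I_w) + 1 = 2·Σ_(k ≤ j) q_v^k`

Topic `NumberTheory/Rogawski1990`; namespace `Literature.NumberTheory.Automorphic.UnitaryGroup`.  THEOREMS ONLY (no definition, no instance, no notation, no named
fact, no `sorry`).  Cell `pub/hodgecm-mathlib`, crux H413 = `stmt-HodgeConjecture-24833`; LH4 price list (4), dealer LH4-plan (g6) WORD #79 (P5f) «B2″», retiring MEMO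
«M6 ∕ EULER–POINCARÉ AT A WILD TYPE-(2) ROW» (B-p08 (g40), sha16 544dfdf1cc8f9c98) §4 row «supplier B2 `UnitaryTwoTypeTwoEdgeCount` (`h2v`)»; this file F0P3a-p09 (g9).
HONEST LABEL: HC_CM is proved only modulo the cell's remaining named inputs (hLiu418 = stmt-HodgeConjecture-24832, h413 = stmt-HodgeConjecture-24833) until rung 0 closes;
(D-UNR) stays PRINT; this is a count-neutral twin that asserts nothing printed.

THE TWIN.  ★ `Rogawski1990/UnitaryTwoTypeTwoEdgeCount` counts the `γ`-fixed vertices `V`, interior vertices `S` and edges `E₂` of the tree of `U_w = U(σ_w, (Φ₂)_w)` for a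
type-(2) elliptic `γ` under `|2|_w = 1`, reading the centre `c = tr γ∕2`, the square relation `(k − c·1)² = e·1`, `e = (tr² − 4det)∕4`, and the radius `N` off
`|tr² − 4det| = exp(−(2N+1))`.  Here (memo §2(e)∕§3) the centre is the EISENSTEIN centre `a ∈ 𝒪_w` (the `1`-coordinate of the eigenvalue `λ = a + b·Π_row`), the relation is
AFFINE `M·M = f·M + e′·1` (`M = γ − a·1`, `|f| ≤ |ϖ^(j+1)|`, `|e′| = |ϖ^(2j+1)|`), the radius is `j`, and `|σ(a)a − 1| < 1`; the weak CENTRING socket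
`|g₁₀·σa + σ(g₁₀)·a| ≤ |g₁₀|·|ϖ^(j+1)|` (frame-independent form of ★ (P5c)'s `hβa′` — at `|2| = 1` it follows from the cyclic-frame relation `g₁₀ σtr + σg₁₀ tr = 0`) is a
hypothesis.  Nothing else changes: the isotropic cyclic frame (★ `exists_rescaled_cyclicFrame`, 2-free), the frame transports (★ `ncard_selfDualStable_congr`,
★ `ncard_selfDualStable_subSmul_congr`, ★ `natCard_fixedBy_unitary_subtype_eq_ncard`), the dockings and the row-blind assembly `E₂ + 1 = (q+1)S + (V − S) + 1 = 2V`
(`V = q·S + 1`) are VERBATIM; the three counts come from ★ (P5c-II) `ncard_selfDualStable_antidiag_companion_affine_eq_sum` (`V = Σ_(k≤j) q^k`), ★ (P5c-IV)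
`ncard_selfDualStable_affineReduction_antidiag_companion_eq_sum` (`S = Σ_(k<j) q^k`) and ★ (P5b) `natCard_fixedBy_iwahori_eq_add_mul_of_sub_smul_one_affine` (`E₂ = V + q·S`).

## References
* [Kottwitz1988] R. E. Kottwitz, *Tamagawa numbers*, Ann. of Math. 127 (1988), 629–646, §2 Theorem 2.
* [Serre1980Trees] J.-P. Serre, *Trees* (1980), Ch. II §1.1, Ch. I §6.
* [Rogawski1990] J. D. Rogawski, *Automorphic Representations of Unitary Groups in Three Variables* (1990), §3.6 p. 31, §4.9 p. 55, §12.6 p. 174.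
* [Flicker1998UnitaryFL] Y. Z. Flicker, *Elementary proof of the fundamental lemma for a unitary group*, Canad. J. Math. 50 (1998), §6 p. 97.
-/

set_option autoImplicit false

noncomputable section

open MeasureTheory NumberField IsDedekindDomain Matrix Finset ValuativeRel
open scoped ValuativeRel Matrix MatrixGroups

namespace Literature.NumberTheory.Automorphic.UnitaryGroup

open Literature.NumberTheory.Rogawski1990

/-! ## §3 The counts at `w` with the Eisenstein centre: lattices and fixed cosets -/

section Count

variable (L : Type) [Field L] [NumberField L] [IsCMField L] (v : HeightOneSpectrum (𝓞 ↥(maximalRealSubfield L)))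
  (w : PlacesOver L v) (hw : IsCMField.complexConj L • w.1 = w.1)

set_option maxHeartbeats 800000 in
include hw in
/-- **THE SELF-DUAL LATTICE COUNT AT `w`, EISENSTEIN CENTRE**: for `g ∈ GL₂(L_w)` unitary for `(Φ₂)_w`, `χ_g` without root in `L_w`, with the affine relation
`(g − a·1)² = f·(g − a·1) + e′·1` (`a ∈ 𝒪`, `|f| ≤ |ϖ^(j+1)|`, `|e′| = |ϖ^(2j+1)|`) and the weak centring socket `|g₁₀·σa + σ(g₁₀)·a| ≤ |g₁₀·ϖ^(j+1)|`:
`#S((Φ₂)_w, g) = Σ_(k ≤ j) q_v^k` (★ `exists_rescaled_cyclicFrame` ∘ ★ `ncard_selfDualStable_congr` ∘ ★ (P5c-II)).  Twin of ★ B-p10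
`ncard_selfDualStable_antidiagTwo_eq_sum_of_unitary` (`|2| = 1`, radius `N`). [cite: Kottwitz1988, §2] [cite: Flicker1998UnitaryFL, §6 p. 97] -/
theorem ncard_selfDualStable_antidiagTwo_eq_sum_of_unitary_affine (hunr : Algebra.IsUnramifiedIn (𝓞 L) v.asIdeal)
    (gGL : GL (Fin 2) (w.1.adicCompletion L)) (g : Matrix (Fin 2) (Fin 2) (w.1.adicCompletion L)) (hcoe : (gGL : Matrix (Fin 2) (Fin 2) (w.1.adicCompletion L)) = g)
    (hgU : (g.map (galAdicCompletionMap (L := L) (IsCMField.complexConj L) hw))ᵀ * (!![0, 1; 1, 0] : Matrix (Fin 2) (Fin 2) (w.1.adicCompletion L)) * g = !![0, 1; 1, 0])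
    (hirr : ¬ ∃ x : (w.1.adicCompletion L), (g.charpoly).IsRoot x)
    {a f e' : (w.1.adicCompletion L)} (ha : a ∈ 𝒪[(w.1.adicCompletion L)]) {j : ℕ}
    (hf : valuation (w.1.adicCompletion L) f ≤ valuation (w.1.adicCompletion L) ((toPlace v w (GaloisRepresentations.HeckeCharacter.uniformizer ↥(maximalRealSubfield L) v : v.adicCompletion ↥(maximalRealSubfield L))) ^ (j + 1)))
    (hj : valuation (w.1.adicCompletion L) e' = valuation (w.1.adicCompletion L) ((toPlace v w (GaloisRepresentations.HeckeCharacter.uniformizer ↥(maximalRealSubfield L) v : v.adicCompletion ↥(maximalRealSubfield L))) ^ (2 * j + 1)))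
    (hk : (g - a • (1 : Matrix (Fin 2) (Fin 2) (w.1.adicCompletion L))) * (g - a • (1 : Matrix (Fin 2) (Fin 2) (w.1.adicCompletion L))) = f • (g - a • (1 : Matrix (Fin 2) (Fin 2) (w.1.adicCompletion L))) + e' • (1 : Matrix (Fin 2) (Fin 2) (w.1.adicCompletion L)))
    (hga' : valuation (w.1.adicCompletion L) (g 1 0 * (galAdicCompletionMap (L := L) (IsCMField.complexConj L) hw) a + (galAdicCompletionMap (L := L) (IsCMField.complexConj L) hw) (g 1 0) * a) ≤ valuation (w.1.adicCompletion L) (g 1 0 * (toPlace v w (GaloisRepresentations.HeckeCharacter.uniformizer ↥(maximalRealSubfield L) v : v.adicCompletion ↥(maximalRealSubfield L))) ^ (j + 1))) :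
    {Λ : Submodule 𝒪[(w.1.adicCompletion L)] (Fin 2 → (w.1.adicCompletion L)) |
        (∃ g' : GL (Fin 2) (w.1.adicCompletion L), (∃ J' ∈ glInt 2 (w.1.adicCompletion L), (J' : Matrix (Fin 2) (Fin 2) (w.1.adicCompletion L)) =
            formCongr (galAdicCompletionMap (L := L) (IsCMField.complexConj L) hw) g' (placeForm (Matrix.of fun i j : Fin 2 => if i.val + j.val + 1 = 2 then (1 : L) else 0) w.1)) ∧
          Λ = Submodule.span 𝒪[(w.1.adicCompletion L)] (Set.range ((g' : Matrix (Fin 2) (Fin 2) (w.1.adicCompletion L)))ᵀ)) ∧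
        Λ.map ((Matrix.toLin' ((gGL : GL (Fin 2) (w.1.adicCompletion L)) : Matrix (Fin 2) (Fin 2) (w.1.adicCompletion L))).restrictScalars 𝒪[(w.1.adicCompletion L)]) = Λ}.ncard =
      ∑ k ∈ range (j + 1), Nat.card (𝓞 ↥(maximalRealSubfield L) ⧸ v.asIdeal) ^ k := by
  classical
  have hc1 : IsCMField.complexConj L ≠ 1 := IsCMField.complexConj_ne_one L
  have hϖv := Liu2021.LemD1IndexedNonVacuityInertCofinite.valued_toPlace_uniformizer_of_isUnramifiedIn L v hunr w
  have hϖ : IsUniformizingElement (toPlace v w (GaloisRepresentations.HeckeCharacter.uniformizer ↥(maximalRealSubfield L) v : v.adicCompletion ↥(maximalRealSubfield L))) := isUniformizingElement_of_v_eq hϖv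
  have h0 := hϖ.ne_zero
  haveI : IsDiscreteValuationRing 𝒪[(w.1.adicCompletion L)] := isDiscreteValuationRing_integer_of_compatible hϖv
  have hσO : ∀ x : 𝒪[(w.1.adicCompletion L)], (galAdicCompletionMap (L := L) (IsCMField.complexConj L) hw) x ∈ 𝒪[(w.1.adicCompletion L)] := mem_integer_galAdicCompletionMap (IsCMField.complexConj L) v w hw
  let σO : 𝒪[(w.1.adicCompletion L)] →+* 𝒪[(w.1.adicCompletion L)] := (((galAdicCompletionMap (L := L) (IsCMField.complexConj L) hw)).comp (𝒪[(w.1.adicCompletion L)]).subtype).codRestrict 𝒪[(w.1.adicCompletion L)] fun x => hσO x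
  have hσO' : ∀ x : 𝒪[(w.1.adicCompletion L)], ((σO x : 𝒪[(w.1.adicCompletion L)]) : (w.1.adicCompletion L)) = (galAdicCompletionMap (L := L) (IsCMField.complexConj L) hw) x := fun _ => rfl
  have hσσ : ∀ x, σO (σO x) = x := fun x =>
    Subtype.ext (galAdicCompletionMap_galAdicCompletionMap_of_smul_eq (IsCMField.complexConj L) w hc1 hw (x : (w.1.adicCompletion L)))
  have hσϖ : (galAdicCompletionMap (L := L) (IsCMField.complexConj L) hw) (toPlace v w (GaloisRepresentations.HeckeCharacter.uniformizer ↥(maximalRealSubfield L) v : v.adicCompletion ↥(maximalRealSubfield L))) = (toPlace v w (GaloisRepresentations.HeckeCharacter.uniformizer ↥(maximalRealSubfield L) v : v.adicCompletion ↥(maximalRealSubfield L))) := galAdicCompletionMap_toPlace (IsCMField.complexConj L) w w hw _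
  have hσv : ∀ x, valuation (w.1.adicCompletion L) ((galAdicCompletionMap (L := L) (IsCMField.complexConj L) hw) x) = valuation (w.1.adicCompletion L) x := fun x => valuation_galAdicCompletionMap_eq (IsCMField.complexConj L) v w hw x
  obtain ⟨σk, hσk⟩ := exists_residueField_ringHom_galAdicCompletionMap (IsCMField.complexConj L) v w hw
  have hq : Nat.card 𝓀[(w.1.adicCompletion L)] = Nat.card (𝓞 ↥(maximalRealSubfield L) ⧸ v.asIdeal) ^ 2 := natCard_residueField_eq_sq_of_inert (IsCMField.complexConj L) v hc1 hunr w hw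
  letI : Fintype 𝓀[(w.1.adicCompletion L)] := Fintype.ofFinite _
  have hq' : Fintype.card 𝓀[(w.1.adicCompletion L)] = Nat.card (𝓞 ↥(maximalRealSubfield L) ⧸ v.asIdeal) ^ 2 := by rw [← Nat.card_eq_fintype_card, hq]
  obtain ⟨a₀, ha₀⟩ := LocalFields.UnramifiedQuadraticNorm.exists_isUnit_map_sub_of_residueHom_ne (galAdicCompletionMap (L := L) (IsCMField.complexConj L) hw) hσO σk hσk
    (Literature.LinearAlgebra.Matrix.exists_frob_ne hq' σk (residueHom_galAdicCompletionMap_eq_pow (IsCMField.complexConj L) v hc1 hunr w hw σk hσO hσk))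
  have ha₀' : IsUnit (σO a₀ - a₀) := ha₀
  -- `g₁₀ ≠ 0` (else `g₀₀` is a root of `χ_g`)
  have hg10 : g 1 0 ≠ 0 := fun h10 => hirr ⟨g 0 0, by
    rw [Polynomial.IsRoot, Matrix.charpoly_fin_two, Matrix.trace_fin_two, Matrix.det_fin_two, h10]
    simp; ring⟩
  -- rescaling exponent: `|g₁₀| = |ϖ^m|`, `m = 2r + e`, `c := ϖ^(−r)` (verbatim from ★ B2 §3, the scalar renamed `c`)
  obtain ⟨m, hm⟩ := exists_valuation_eq_valuation_zpow hϖ hg10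
  obtain ⟨r, e, he, hme⟩ : ∃ (r : ℤ) (e : ℕ), e ≤ 1 ∧ m = 2 * r + e := ⟨m / 2, (m % 2).toNat, by omega, by omega⟩
  obtain ⟨c, hc⟩ : ∃ c : (w.1.adicCompletion L), (toPlace v w (GaloisRepresentations.HeckeCharacter.uniformizer ↥(maximalRealSubfield L) v : v.adicCompletion ↥(maximalRealSubfield L))) ^ (-r) = c := ⟨_, rfl⟩
  have hc0 : c ≠ 0 := by rw [← hc]; exact zpow_ne_zero _ h0
  have hσc : (galAdicCompletionMap (L := L) (IsCMField.complexConj L) hw) c = c := by rw [← hc, map_zpow₀, hσϖ]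
  -- the rescaled isotropic cyclic frame (★ B-p10 §1, 2-free)
  have hex := exists_rescaled_cyclicFrame (galAdicCompletionMap (L := L) (IsCMField.complexConj L) hw) gGL g hcoe hgU hg10 hc0 hσc
  rcases hex with ⟨P', hP'⟩
  have hC' := hP'.1
  have hform' := hP'.2.1
  have hdβ := hP'.2.2.1
  -- valuations: `|det g| = 1`, `|β| = |ϖ^e|` for `β := c²·g₁₀`
  have hdv : valuation (w.1.adicCompletion L) g.det = 1 := by
    have h := congrArg (valuation (w.1.adicCompletion L)) hdβ
    rw [map_mul, Valuation.map_neg, hσv] at h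
    exact mul_right_cancel₀ ((Valuation.ne_zero_iff _).2 hg10) (h.trans (one_mul _).symm)
  have hβ' : valuation (w.1.adicCompletion L) (c ^ 2 * g 1 0) = valuation (w.1.adicCompletion L) ((toPlace v w (GaloisRepresentations.HeckeCharacter.uniformizer ↥(maximalRealSubfield L) v : v.adicCompletion ↥(maximalRealSubfield L))) ^ e) := by
    rw [map_mul, hm, ← map_mul, ← hc, ← zpow_natCast ((toPlace v w (GaloisRepresentations.HeckeCharacter.uniformizer ↥(maximalRealSubfield L) v : v.adicCompletion ↥(maximalRealSubfield L))) ^ (-r)), ← _root_.zpow_mul, ← zpow_add₀ h0, ← zpow_natCast]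
    congr 2; push_cast; omega
  -- the affine relation for the companion `γ' := P'⁻¹ g P'` (★ (P5d) transport)
  have hγa : ((((P'⁻¹ * gGL * P' : GL (Fin 2) (w.1.adicCompletion L))) : Matrix (Fin 2) (Fin 2) (w.1.adicCompletion L)) - a • (1 : Matrix (Fin 2) (Fin 2) (w.1.adicCompletion L))) * ((((P'⁻¹ * gGL * P' : GL (Fin 2) (w.1.adicCompletion L))) : Matrix (Fin 2) (Fin 2) (w.1.adicCompletion L)) - a • (1 : Matrix (Fin 2) (Fin 2) (w.1.adicCompletion L))) =
      f • ((((P'⁻¹ * gGL * P' : GL (Fin 2) (w.1.adicCompletion L))) : Matrix (Fin 2) (Fin 2) (w.1.adicCompletion L)) - a • (1 : Matrix (Fin 2) (Fin 2) (w.1.adicCompletion L))) + e' • (1 : Matrix (Fin 2) (Fin 2) (w.1.adicCompletion L)) := by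
    have h := units_inv_mul_mul_affine_of_affine P' g hk
    rw [← hcoe] at h
    simpa only [Units.val_mul] using h
  -- the weak centring socket for `β = c²·g₁₀`: `|β·σa + σβ·a| ≤ |ϖ^(j+1+e)|` from `hga'`
  have hβa' : valuation (w.1.adicCompletion L) (c ^ 2 * g 1 0 * (galAdicCompletionMap (L := L) (IsCMField.complexConj L) hw) a + (galAdicCompletionMap (L := L) (IsCMField.complexConj L) hw) (c ^ 2 * g 1 0) * a) ≤ valuation (w.1.adicCompletion L) ((toPlace v w (GaloisRepresentations.HeckeCharacter.uniformizer ↥(maximalRealSubfield L) v : v.adicCompletion ↥(maximalRealSubfield L))) ^ (j + 1 + e)) := by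
    have hfac : c ^ 2 * g 1 0 * (galAdicCompletionMap (L := L) (IsCMField.complexConj L) hw) a + (galAdicCompletionMap (L := L) (IsCMField.complexConj L) hw) (c ^ 2 * g 1 0) * a = c ^ 2 * (g 1 0 * (galAdicCompletionMap (L := L) (IsCMField.complexConj L) hw) a + (galAdicCompletionMap (L := L) (IsCMField.complexConj L) hw) (g 1 0) * a) := by
      rw [map_mul, map_pow, hσc]; ring
    rw [hfac, map_mul]
    calc valuation (w.1.adicCompletion L) (c ^ 2) * valuation (w.1.adicCompletion L) (g 1 0 * (galAdicCompletionMap (L := L) (IsCMField.complexConj L) hw) a + (galAdicCompletionMap (L := L) (IsCMField.complexConj L) hw) (g 1 0) * a)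
        ≤ valuation (w.1.adicCompletion L) (c ^ 2) * valuation (w.1.adicCompletion L) (g 1 0 * (toPlace v w (GaloisRepresentations.HeckeCharacter.uniformizer ↥(maximalRealSubfield L) v : v.adicCompletion ↥(maximalRealSubfield L))) ^ (j + 1)) := mul_le_mul_right hga' _
      _ = valuation (w.1.adicCompletion L) ((toPlace v w (GaloisRepresentations.HeckeCharacter.uniformizer ↥(maximalRealSubfield L) v : v.adicCompletion ↥(maximalRealSubfield L))) ^ (j + 1 + e)) := by
          rw [← map_mul, ← mul_assoc, map_mul, hβ', ← map_mul, ← pow_add, add_comm]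
  -- the transported FORM as a binder (no rewriting inside the self-dual set at the place)
  have hH : formCongr (galAdicCompletionMap (L := L) (IsCMField.complexConj L) hw) P' (placeForm (Matrix.of fun i j : Fin 2 => if i.val + j.val + 1 = 2 then (1 : L) else 0) w.1) = !![0, c ^ 2 * g 1 0; (galAdicCompletionMap (L := L) (IsCMField.complexConj L) hw) (c ^ 2 * g 1 0), 0] := by
    rw [placeForm_antidiagTwo_eq_antidiag L v w]; exact hform'
  rw [ncard_selfDualStable_congr (galAdicCompletionMap (L := L) (IsCMField.complexConj L) hw) (placeForm (Matrix.of fun i j : Fin 2 => if i.val + j.val + 1 = 2 then (1 : L) else 0) w.1) gGL P']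
  have h := ncard_selfDualStable_antidiag_companion_affine_eq_sum hϖ (galAdicCompletionMap (L := L) (IsCMField.complexConj L) hw) σO hσO' hσσ hσϖ hσv hdv he hβ' (P'⁻¹ * gGL * P') hC' ha hf hj hγa hβa' ha₀' hq
  rw [← hH] at h
  exact h

set_option maxHeartbeats 800000 in
include hw in
/-- **THE REFINED (INTERIOR) LATTICE COUNT AT `w`, EISENSTEIN CENTRE**: under the same hypotheses,
`#{Λ ∈ S((Φ₂)_w, g) | (g − a·1)·Λ ≤ ϖ·Λ} = Σ_(k < j) q_v^k` — the interior vertices of the fixed ball, at which every local monodromy reduces to the scalar `ā`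
(★ `exists_rescaled_cyclicFrame` ∘ ★ FILE A `ncard_selfDualStable_subSmul_congr` ∘ ★ (P5c-IV)).  Twin of ★ `ncard_selfDualStable_scalarReduction_antidiagTwo_eq_sum_of_unitary`
(`|2| = 1`, centre `tr∕2`, radius `N`). [cite: Kottwitz1988, §2] [cite: Flicker1998UnitaryFL, §6 p. 97] -/
theorem ncard_selfDualStable_affineReduction_antidiagTwo_eq_sum_of_unitary (hunr : Algebra.IsUnramifiedIn (𝓞 L) v.asIdeal)
    (gGL : GL (Fin 2) (w.1.adicCompletion L)) (g : Matrix (Fin 2) (Fin 2) (w.1.adicCompletion L)) (hcoe : (gGL : Matrix (Fin 2) (Fin 2) (w.1.adicCompletion L)) = g)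
    (hgU : (g.map (galAdicCompletionMap (L := L) (IsCMField.complexConj L) hw))ᵀ * (!![0, 1; 1, 0] : Matrix (Fin 2) (Fin 2) (w.1.adicCompletion L)) * g = !![0, 1; 1, 0])
    (hirr : ¬ ∃ x : (w.1.adicCompletion L), (g.charpoly).IsRoot x)
    {a f e' : (w.1.adicCompletion L)} (ha : a ∈ 𝒪[(w.1.adicCompletion L)]) {j : ℕ}
    (hf : valuation (w.1.adicCompletion L) f ≤ valuation (w.1.adicCompletion L) ((toPlace v w (GaloisRepresentations.HeckeCharacter.uniformizer ↥(maximalRealSubfield L) v : v.adicCompletion ↥(maximalRealSubfield L))) ^ (j + 1)))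
    (hj : valuation (w.1.adicCompletion L) e' = valuation (w.1.adicCompletion L) ((toPlace v w (GaloisRepresentations.HeckeCharacter.uniformizer ↥(maximalRealSubfield L) v : v.adicCompletion ↥(maximalRealSubfield L))) ^ (2 * j + 1)))
    (hk : (g - a • (1 : Matrix (Fin 2) (Fin 2) (w.1.adicCompletion L))) * (g - a • (1 : Matrix (Fin 2) (Fin 2) (w.1.adicCompletion L))) = f • (g - a • (1 : Matrix (Fin 2) (Fin 2) (w.1.adicCompletion L))) + e' • (1 : Matrix (Fin 2) (Fin 2) (w.1.adicCompletion L)))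
    (hga' : valuation (w.1.adicCompletion L) (g 1 0 * (galAdicCompletionMap (L := L) (IsCMField.complexConj L) hw) a + (galAdicCompletionMap (L := L) (IsCMField.complexConj L) hw) (g 1 0) * a) ≤ valuation (w.1.adicCompletion L) (g 1 0 * (toPlace v w (GaloisRepresentations.HeckeCharacter.uniformizer ↥(maximalRealSubfield L) v : v.adicCompletion ↥(maximalRealSubfield L))) ^ (j + 1))) :
    {Λ : Submodule 𝒪[(w.1.adicCompletion L)] (Fin 2 → (w.1.adicCompletion L)) |
        ((∃ g' : GL (Fin 2) (w.1.adicCompletion L), (∃ J' ∈ glInt 2 (w.1.adicCompletion L), (J' : Matrix (Fin 2) (Fin 2) (w.1.adicCompletion L)) =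
            formCongr (galAdicCompletionMap (L := L) (IsCMField.complexConj L) hw) g' (placeForm (Matrix.of fun i j : Fin 2 => if i.val + j.val + 1 = 2 then (1 : L) else 0) w.1)) ∧
          Λ = Submodule.span 𝒪[(w.1.adicCompletion L)] (Set.range ((g' : Matrix (Fin 2) (Fin 2) (w.1.adicCompletion L)))ᵀ)) ∧
        Λ.map ((Matrix.toLin' ((gGL : GL (Fin 2) (w.1.adicCompletion L)) : Matrix (Fin 2) (Fin 2) (w.1.adicCompletion L))).restrictScalars 𝒪[(w.1.adicCompletion L)]) = Λ) ∧
        Λ.map ((Matrix.toLin' (((gGL : GL (Fin 2) (w.1.adicCompletion L)) : Matrix (Fin 2) (Fin 2) (w.1.adicCompletion L)) - a • (1 : Matrix (Fin 2) (Fin 2) (w.1.adicCompletion L)))).restrictScalars 𝒪[(w.1.adicCompletion L)]) ≤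
          Λ.map ((Matrix.toLin' (((toPlace v w (GaloisRepresentations.HeckeCharacter.uniformizer ↥(maximalRealSubfield L) v : v.adicCompletion ↥(maximalRealSubfield L))) : (w.1.adicCompletion L)) • (1 : Matrix (Fin 2) (Fin 2) (w.1.adicCompletion L)))).restrictScalars 𝒪[(w.1.adicCompletion L)])}.ncard =
      ∑ k ∈ range j, Nat.card (𝓞 ↥(maximalRealSubfield L) ⧸ v.asIdeal) ^ k := by
  classical
  have hc1 : IsCMField.complexConj L ≠ 1 := IsCMField.complexConj_ne_one L
  have hϖv := Liu2021.LemD1IndexedNonVacuityInertCofinite.valued_toPlace_uniformizer_of_isUnramifiedIn L v hunr w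
  have hϖ : IsUniformizingElement (toPlace v w (GaloisRepresentations.HeckeCharacter.uniformizer ↥(maximalRealSubfield L) v : v.adicCompletion ↥(maximalRealSubfield L))) := isUniformizingElement_of_v_eq hϖv
  have h0 := hϖ.ne_zero
  haveI : IsDiscreteValuationRing 𝒪[(w.1.adicCompletion L)] := isDiscreteValuationRing_integer_of_compatible hϖv
  have hσO : ∀ x : 𝒪[(w.1.adicCompletion L)], (galAdicCompletionMap (L := L) (IsCMField.complexConj L) hw) x ∈ 𝒪[(w.1.adicCompletion L)] := mem_integer_galAdicCompletionMap (IsCMField.complexConj L) v w hw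
  let σO : 𝒪[(w.1.adicCompletion L)] →+* 𝒪[(w.1.adicCompletion L)] := (((galAdicCompletionMap (L := L) (IsCMField.complexConj L) hw)).comp (𝒪[(w.1.adicCompletion L)]).subtype).codRestrict 𝒪[(w.1.adicCompletion L)] fun x => hσO x
  have hσO' : ∀ x : 𝒪[(w.1.adicCompletion L)], ((σO x : 𝒪[(w.1.adicCompletion L)]) : (w.1.adicCompletion L)) = (galAdicCompletionMap (L := L) (IsCMField.complexConj L) hw) x := fun _ => rfl
  have hσσ : ∀ x, σO (σO x) = x := fun x =>
    Subtype.ext (galAdicCompletionMap_galAdicCompletionMap_of_smul_eq (IsCMField.complexConj L) w hc1 hw (x : (w.1.adicCompletion L)))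
  have hσϖ : (galAdicCompletionMap (L := L) (IsCMField.complexConj L) hw) (toPlace v w (GaloisRepresentations.HeckeCharacter.uniformizer ↥(maximalRealSubfield L) v : v.adicCompletion ↥(maximalRealSubfield L))) = (toPlace v w (GaloisRepresentations.HeckeCharacter.uniformizer ↥(maximalRealSubfield L) v : v.adicCompletion ↥(maximalRealSubfield L))) := galAdicCompletionMap_toPlace (IsCMField.complexConj L) w w hw _
  have hσv : ∀ x, valuation (w.1.adicCompletion L) ((galAdicCompletionMap (L := L) (IsCMField.complexConj L) hw) x) = valuation (w.1.adicCompletion L) x := fun x => valuation_galAdicCompletionMap_eq (IsCMField.complexConj L) v w hw x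
  obtain ⟨σk, hσk⟩ := exists_residueField_ringHom_galAdicCompletionMap (IsCMField.complexConj L) v w hw
  have hq : Nat.card 𝓀[(w.1.adicCompletion L)] = Nat.card (𝓞 ↥(maximalRealSubfield L) ⧸ v.asIdeal) ^ 2 := natCard_residueField_eq_sq_of_inert (IsCMField.complexConj L) v hc1 hunr w hw
  letI : Fintype 𝓀[(w.1.adicCompletion L)] := Fintype.ofFinite _
  have hq' : Fintype.card 𝓀[(w.1.adicCompletion L)] = Nat.card (𝓞 ↥(maximalRealSubfield L) ⧸ v.asIdeal) ^ 2 := by rw [← Nat.card_eq_fintype_card, hq]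
  obtain ⟨a₀, ha₀⟩ := LocalFields.UnramifiedQuadraticNorm.exists_isUnit_map_sub_of_residueHom_ne (galAdicCompletionMap (L := L) (IsCMField.complexConj L) hw) hσO σk hσk
    (Literature.LinearAlgebra.Matrix.exists_frob_ne hq' σk (residueHom_galAdicCompletionMap_eq_pow (IsCMField.complexConj L) v hc1 hunr w hw σk hσO hσk))
  have ha₀' : IsUnit (σO a₀ - a₀) := ha₀
  -- `g₁₀ ≠ 0` (else `g₀₀` is a root of `χ_g`)
  have hg10 : g 1 0 ≠ 0 := fun h10 => hirr ⟨g 0 0, by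
    rw [Polynomial.IsRoot, Matrix.charpoly_fin_two, Matrix.trace_fin_two, Matrix.det_fin_two, h10]
    simp; ring⟩
  -- rescaling exponent: `|g₁₀| = |ϖ^m|`, `m = 2r + e`, `c := ϖ^(−r)` (verbatim from ★ B2 §3, the scalar renamed `c`)
  obtain ⟨m, hm⟩ := exists_valuation_eq_valuation_zpow hϖ hg10
  obtain ⟨r, e, he, hme⟩ : ∃ (r : ℤ) (e : ℕ), e ≤ 1 ∧ m = 2 * r + e := ⟨m / 2, (m % 2).toNat, by omega, by omega⟩
  obtain ⟨c, hc⟩ : ∃ c : (w.1.adicCompletion L), (toPlace v w (GaloisRepresentations.HeckeCharacter.uniformizer ↥(maximalRealSubfield L) v : v.adicCompletion ↥(maximalRealSubfield L))) ^ (-r) = c := ⟨_, rfl⟩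
  have hc0 : c ≠ 0 := by rw [← hc]; exact zpow_ne_zero _ h0
  have hσc : (galAdicCompletionMap (L := L) (IsCMField.complexConj L) hw) c = c := by rw [← hc, map_zpow₀, hσϖ]
  -- the rescaled isotropic cyclic frame (★ B-p10 §1, 2-free)
  have hex := exists_rescaled_cyclicFrame (galAdicCompletionMap (L := L) (IsCMField.complexConj L) hw) gGL g hcoe hgU hg10 hc0 hσc
  rcases hex with ⟨P', hP'⟩
  have hC' := hP'.1
  have hform' := hP'.2.1
  have hdβ := hP'.2.2.1
  -- valuations: `|det g| = 1`, `|β| = |ϖ^e|` for `β := c²·g₁₀`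
  have hdv : valuation (w.1.adicCompletion L) g.det = 1 := by
    have h := congrArg (valuation (w.1.adicCompletion L)) hdβ
    rw [map_mul, Valuation.map_neg, hσv] at h
    exact mul_right_cancel₀ ((Valuation.ne_zero_iff _).2 hg10) (h.trans (one_mul _).symm)
  have hβ' : valuation (w.1.adicCompletion L) (c ^ 2 * g 1 0) = valuation (w.1.adicCompletion L) ((toPlace v w (GaloisRepresentations.HeckeCharacter.uniformizer ↥(maximalRealSubfield L) v : v.adicCompletion ↥(maximalRealSubfield L))) ^ e) := by
    rw [map_mul, hm, ← map_mul, ← hc, ← zpow_natCast ((toPlace v w (GaloisRepresentations.HeckeCharacter.uniformizer ↥(maximalRealSubfield L) v : v.adicCompletion ↥(maximalRealSubfield L))) ^ (-r)), ← _root_.zpow_mul, ← zpow_add₀ h0, ← zpow_natCast]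
    congr 2; push_cast; omega
  -- the affine relation for the companion `γ' := P'⁻¹ g P'` (★ (P5d) transport)
  have hγa : ((((P'⁻¹ * gGL * P' : GL (Fin 2) (w.1.adicCompletion L))) : Matrix (Fin 2) (Fin 2) (w.1.adicCompletion L)) - a • (1 : Matrix (Fin 2) (Fin 2) (w.1.adicCompletion L))) * ((((P'⁻¹ * gGL * P' : GL (Fin 2) (w.1.adicCompletion L))) : Matrix (Fin 2) (Fin 2) (w.1.adicCompletion L)) - a • (1 : Matrix (Fin 2) (Fin 2) (w.1.adicCompletion L))) =
      f • ((((P'⁻¹ * gGL * P' : GL (Fin 2) (w.1.adicCompletion L))) : Matrix (Fin 2) (Fin 2) (w.1.adicCompletion L)) - a • (1 : Matrix (Fin 2) (Fin 2) (w.1.adicCompletion L))) + e' • (1 : Matrix (Fin 2) (Fin 2) (w.1.adicCompletion L)) := by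
    have h := units_inv_mul_mul_affine_of_affine P' g hk
    rw [← hcoe] at h
    simpa only [Units.val_mul] using h
  -- the weak centring socket for `β = c²·g₁₀`: `|β·σa + σβ·a| ≤ |ϖ^(j+1+e)|` from `hga'`
  have hβa' : valuation (w.1.adicCompletion L) (c ^ 2 * g 1 0 * (galAdicCompletionMap (L := L) (IsCMField.complexConj L) hw) a + (galAdicCompletionMap (L := L) (IsCMField.complexConj L) hw) (c ^ 2 * g 1 0) * a) ≤ valuation (w.1.adicCompletion L) ((toPlace v w (GaloisRepresentations.HeckeCharacter.uniformizer ↥(maximalRealSubfield L) v : v.adicCompletion ↥(maximalRealSubfield L))) ^ (j + 1 + e)) := by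
    have hfac : c ^ 2 * g 1 0 * (galAdicCompletionMap (L := L) (IsCMField.complexConj L) hw) a + (galAdicCompletionMap (L := L) (IsCMField.complexConj L) hw) (c ^ 2 * g 1 0) * a = c ^ 2 * (g 1 0 * (galAdicCompletionMap (L := L) (IsCMField.complexConj L) hw) a + (galAdicCompletionMap (L := L) (IsCMField.complexConj L) hw) (g 1 0) * a) := by
      rw [map_mul, map_pow, hσc]; ring
    rw [hfac, map_mul]
    calc valuation (w.1.adicCompletion L) (c ^ 2) * valuation (w.1.adicCompletion L) (g 1 0 * (galAdicCompletionMap (L := L) (IsCMField.complexConj L) hw) a + (galAdicCompletionMap (L := L) (IsCMField.complexConj L) hw) (g 1 0) * a)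
        ≤ valuation (w.1.adicCompletion L) (c ^ 2) * valuation (w.1.adicCompletion L) (g 1 0 * (toPlace v w (GaloisRepresentations.HeckeCharacter.uniformizer ↥(maximalRealSubfield L) v : v.adicCompletion ↥(maximalRealSubfield L))) ^ (j + 1)) := mul_le_mul_right hga' _
      _ = valuation (w.1.adicCompletion L) ((toPlace v w (GaloisRepresentations.HeckeCharacter.uniformizer ↥(maximalRealSubfield L) v : v.adicCompletion ↥(maximalRealSubfield L))) ^ (j + 1 + e)) := by
          rw [← map_mul, ← mul_assoc, map_mul, hβ', ← map_mul, ← pow_add, add_comm]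
  -- the transported FORM as a binder (no rewriting inside the self-dual set at the place)
  have hH : formCongr (galAdicCompletionMap (L := L) (IsCMField.complexConj L) hw) P' (placeForm (Matrix.of fun i j : Fin 2 => if i.val + j.val + 1 = 2 then (1 : L) else 0) w.1) = !![0, c ^ 2 * g 1 0; (galAdicCompletionMap (L := L) (IsCMField.complexConj L) hw) (c ^ 2 * g 1 0), 0] := by
    rw [placeForm_antidiagTwo_eq_antidiag L v w]; exact hform'
  rw [ncard_selfDualStable_subSmul_congr (galAdicCompletionMap (L := L) (IsCMField.complexConj L) hw) (placeForm (Matrix.of fun i j : Fin 2 => if i.val + j.val + 1 = 2 then (1 : L) else 0) w.1) gGL P' a ((toPlace v w (GaloisRepresentations.HeckeCharacter.uniformizer ↥(maximalRealSubfield L) v : v.adicCompletion ↥(maximalRealSubfield L))) : (w.1.adicCompletion L))]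
  have h := ncard_selfDualStable_affineReduction_antidiag_companion_eq_sum hϖ (galAdicCompletionMap (L := L) (IsCMField.complexConj L) hw) σO hσO' hσσ hσϖ hσv hdv he hβ' (P'⁻¹ * gGL * P') hC' ha hf hj hγa hβa' ha₀' hq
  rw [← hH] at h
  exact h

include hw in
/-- **THE INTERIOR FIXED VERTICES, GROUP SIDE, EISENSTEIN CENTRE**: the `γ`-fixed cosets `x ∈ U_w ⧸ K_w` whose local monodromy `(out x)⁻¹ γ (out x) ∈ K_w` is
`≡ a·1 (mod ϖ)` number `Σ_(k < j) q_v^k` (★ FILE A `natCard_fixedBy_unitary_subtype_eq_ncard` ∘ ★ docking ∘ the refined lattice count above).  Twin of ★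
`natCard_fixedBy_subtype_scalar_eq_sum_of_unitary` (centre `tr∕2`). [cite: Kottwitz1988, §2] [cite: Flicker1998UnitaryFL, §6 p. 97] -/
theorem natCard_fixedBy_subtype_affine_eq_sum_of_unitary (hunr : Algebra.IsUnramifiedIn (𝓞 L) v.asIdeal) (γ : ↥(unitaryGroupOfForm (galAdicCompletionMap (L := L) (IsCMField.complexConj L) hw) (placeForm (Matrix.of fun i j : Fin 2 => if i.val + j.val + 1 = 2 then (1 : L) else 0) w.1)))
    (hirr : ¬ ∃ x : (w.1.adicCompletion L), ((((γ : GL (Fin 2) (w.1.adicCompletion L))) : Matrix (Fin 2) (Fin 2) (w.1.adicCompletion L)).charpoly).IsRoot x)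
    {a f e' : (w.1.adicCompletion L)} (ha : a ∈ 𝒪[(w.1.adicCompletion L)]) {j : ℕ}
    (hf : valuation (w.1.adicCompletion L) f ≤ valuation (w.1.adicCompletion L) ((toPlace v w (GaloisRepresentations.HeckeCharacter.uniformizer ↥(maximalRealSubfield L) v : v.adicCompletion ↥(maximalRealSubfield L))) ^ (j + 1)))
    (hj : valuation (w.1.adicCompletion L) e' = valuation (w.1.adicCompletion L) ((toPlace v w (GaloisRepresentations.HeckeCharacter.uniformizer ↥(maximalRealSubfield L) v : v.adicCompletion ↥(maximalRealSubfield L))) ^ (2 * j + 1)))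
    (hk : ((((γ : GL (Fin 2) (w.1.adicCompletion L))) : Matrix (Fin 2) (Fin 2) (w.1.adicCompletion L)) - a • (1 : Matrix (Fin 2) (Fin 2) (w.1.adicCompletion L))) * ((((γ : GL (Fin 2) (w.1.adicCompletion L))) : Matrix (Fin 2) (Fin 2) (w.1.adicCompletion L)) - a • (1 : Matrix (Fin 2) (Fin 2) (w.1.adicCompletion L))) = f • ((((γ : GL (Fin 2) (w.1.adicCompletion L))) : Matrix (Fin 2) (Fin 2) (w.1.adicCompletion L)) - a • (1 : Matrix (Fin 2) (Fin 2) (w.1.adicCompletion L))) + e' • (1 : Matrix (Fin 2) (Fin 2) (w.1.adicCompletion L)))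
    (hga' : valuation (w.1.adicCompletion L) ((((γ : GL (Fin 2) (w.1.adicCompletion L))) : Matrix (Fin 2) (Fin 2) (w.1.adicCompletion L)) 1 0 * (galAdicCompletionMap (L := L) (IsCMField.complexConj L) hw) a + (galAdicCompletionMap (L := L) (IsCMField.complexConj L) hw) ((((γ : GL (Fin 2) (w.1.adicCompletion L))) : Matrix (Fin 2) (Fin 2) (w.1.adicCompletion L)) 1 0) * a) ≤ valuation (w.1.adicCompletion L) ((((γ : GL (Fin 2) (w.1.adicCompletion L))) : Matrix (Fin 2) (Fin 2) (w.1.adicCompletion L)) 1 0 * (toPlace v w (GaloisRepresentations.HeckeCharacter.uniformizer ↥(maximalRealSubfield L) v : v.adicCompletion ↥(maximalRealSubfield L))) ^ (j + 1))) :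
    Nat.card {x : MulAction.fixedBy (↥(unitaryGroupOfForm (galAdicCompletionMap (L := L) (IsCMField.complexConj L) hw) (placeForm (Matrix.of fun i j : Fin 2 => if i.val + j.val + 1 = 2 then (1 : L) else 0) w.1)) ⧸ ((glInt 2 (w.1.adicCompletion L)).subgroupOf (unitaryGroupOfForm (galAdicCompletionMap (L := L) (IsCMField.complexConj L) hw) (placeForm (Matrix.of fun i j : Fin 2 => if i.val + j.val + 1 = 2 then (1 : L) else 0) w.1)))) γ //
        ∀ i j, (((toPlace v w (GaloisRepresentations.HeckeCharacter.uniformizer ↥(maximalRealSubfield L) v : v.adicCompletion ↥(maximalRealSubfield L))) : (w.1.adicCompletion L))⁻¹ • (((((x.1.out : ↥(unitaryGroupOfForm (galAdicCompletionMap (L := L) (IsCMField.complexConj L) hw) (placeForm (Matrix.of fun i j : Fin 2 => if i.val + j.val + 1 = 2 then (1 : L) else 0) w.1))) : GL (Fin 2) (w.1.adicCompletion L))⁻¹ : GL (Fin 2) (w.1.adicCompletion L)) : Matrix (Fin 2) (Fin 2) (w.1.adicCompletion L)) *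
          ((((γ : GL (Fin 2) (w.1.adicCompletion L))) : Matrix (Fin 2) (Fin 2) (w.1.adicCompletion L)) - a • (1 : Matrix (Fin 2) (Fin 2) (w.1.adicCompletion L))) * (((x.1.out : ↥(unitaryGroupOfForm (galAdicCompletionMap (L := L) (IsCMField.complexConj L) hw) (placeForm (Matrix.of fun i j : Fin 2 => if i.val + j.val + 1 = 2 then (1 : L) else 0) w.1))) : GL (Fin 2) (w.1.adicCompletion L)) : Matrix (Fin 2) (Fin 2) (w.1.adicCompletion L)))) i j ∈ 𝒪[(w.1.adicCompletion L)]} =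
      ∑ k ∈ range j, Nat.card (𝓞 ↥(maximalRealSubfield L) ⧸ v.asIdeal) ^ k := by
  have hc1 : IsCMField.complexConj L ≠ 1 := IsCMField.complexConj_ne_one L
  have hϖv := Liu2021.LemD1IndexedNonVacuityInertCofinite.valued_toPlace_uniformizer_of_isUnramifiedIn L v hunr w
  have hϖ : IsUniformizingElement (toPlace v w (GaloisRepresentations.HeckeCharacter.uniformizer ↥(maximalRealSubfield L) v : v.adicCompletion ↥(maximalRealSubfield L))) := isUniformizingElement_of_v_eq hϖv
  have hgU : (((((γ : GL (Fin 2) (w.1.adicCompletion L))) : Matrix (Fin 2) (Fin 2) (w.1.adicCompletion L))).map (galAdicCompletionMap (L := L) (IsCMField.complexConj L) hw))ᵀ * (!![0, 1; 1, 0] : Matrix (Fin 2) (Fin 2) (w.1.adicCompletion L)) * (((γ : GL (Fin 2) (w.1.adicCompletion L))) : Matrix (Fin 2) (Fin 2) (w.1.adicCompletion L)) = !![0, 1; 1, 0] := by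
    rw [← placeForm_antidiagTwo_eq_antidiag L v w]; exact mem_unitaryGroupOfForm_iff.1 γ.2
  rw [natCard_fixedBy_unitary_subtype_eq_ncard (galAdicCompletionMap (L := L) (IsCMField.complexConj L) hw) (placeForm (Matrix.of fun i j : Fin 2 => if i.val + j.val + 1 = 2 then (1 : L) else 0) w.1) γ
      ((((γ : GL (Fin 2) (w.1.adicCompletion L))) : Matrix (Fin 2) (Fin 2) (w.1.adicCompletion L)) - a • (1 : Matrix (Fin 2) (Fin 2) (w.1.adicCompletion L))) hϖ.ne_zero,
    ← ncard_selfDualStable_affineReduction_antidiagTwo_eq_sum_of_unitary L v w hw hunr (γ : GL (Fin 2) (w.1.adicCompletion L)) (((γ : GL (Fin 2) (w.1.adicCompletion L))) : Matrix (Fin 2) (Fin 2) (w.1.adicCompletion L)) rfl hgU hirr ha hf hj hk hga']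
  -- (no `rw` under the refined predicate at the place: plain `and_congr_left'` on the docking equivalence)
  congr 1
  ext Λ
  exact and_congr_left' (and_congr_left' (exists_mem_unitary_span_eq_iff_selfDual_of_nonsplit L 2 _ hc1 w hw hunr (antidiagOne_isHermitian L 2)
    (isUnit_placeForm_antidiagOne (E := L) 2 w.1) (unit_placeForm_antidiagOne_mem_glInt (E := L) 2 w.1) Λ))

set_option maxHeartbeats 400000 in
include hw in
/-- **THE FIXED VERTICES, EISENSTEIN CENTRE**: `#Fix_γ(U_w ⧸ K_w) = Σ_(k ≤ j) q_v^k` (★ FILE A fixed-coset dictionary with the vacuous predicate ∘ ★ docking ∘ the lattice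
count above).  Twin of ★ `natCard_fixedBy_glInt_eq_sum_of_unitary`. [cite: Kottwitz1988, §2] [cite: Flicker1998UnitaryFL, §6 p. 97] -/
theorem natCard_fixedBy_glInt_eq_sum_of_unitary_affine (hunr : Algebra.IsUnramifiedIn (𝓞 L) v.asIdeal) (γ : ↥(unitaryGroupOfForm (galAdicCompletionMap (L := L) (IsCMField.complexConj L) hw) (placeForm (Matrix.of fun i j : Fin 2 => if i.val + j.val + 1 = 2 then (1 : L) else 0) w.1)))
    (hirr : ¬ ∃ x : (w.1.adicCompletion L), ((((γ : GL (Fin 2) (w.1.adicCompletion L))) : Matrix (Fin 2) (Fin 2) (w.1.adicCompletion L)).charpoly).IsRoot x)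
    {a f e' : (w.1.adicCompletion L)} (ha : a ∈ 𝒪[(w.1.adicCompletion L)]) {j : ℕ}
    (hf : valuation (w.1.adicCompletion L) f ≤ valuation (w.1.adicCompletion L) ((toPlace v w (GaloisRepresentations.HeckeCharacter.uniformizer ↥(maximalRealSubfield L) v : v.adicCompletion ↥(maximalRealSubfield L))) ^ (j + 1)))
    (hj : valuation (w.1.adicCompletion L) e' = valuation (w.1.adicCompletion L) ((toPlace v w (GaloisRepresentations.HeckeCharacter.uniformizer ↥(maximalRealSubfield L) v : v.adicCompletion ↥(maximalRealSubfield L))) ^ (2 * j + 1)))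
    (hk : ((((γ : GL (Fin 2) (w.1.adicCompletion L))) : Matrix (Fin 2) (Fin 2) (w.1.adicCompletion L)) - a • (1 : Matrix (Fin 2) (Fin 2) (w.1.adicCompletion L))) * ((((γ : GL (Fin 2) (w.1.adicCompletion L))) : Matrix (Fin 2) (Fin 2) (w.1.adicCompletion L)) - a • (1 : Matrix (Fin 2) (Fin 2) (w.1.adicCompletion L))) = f • ((((γ : GL (Fin 2) (w.1.adicCompletion L))) : Matrix (Fin 2) (Fin 2) (w.1.adicCompletion L)) - a • (1 : Matrix (Fin 2) (Fin 2) (w.1.adicCompletion L))) + e' • (1 : Matrix (Fin 2) (Fin 2) (w.1.adicCompletion L)))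
    (hga' : valuation (w.1.adicCompletion L) ((((γ : GL (Fin 2) (w.1.adicCompletion L))) : Matrix (Fin 2) (Fin 2) (w.1.adicCompletion L)) 1 0 * (galAdicCompletionMap (L := L) (IsCMField.complexConj L) hw) a + (galAdicCompletionMap (L := L) (IsCMField.complexConj L) hw) ((((γ : GL (Fin 2) (w.1.adicCompletion L))) : Matrix (Fin 2) (Fin 2) (w.1.adicCompletion L)) 1 0) * a) ≤ valuation (w.1.adicCompletion L) ((((γ : GL (Fin 2) (w.1.adicCompletion L))) : Matrix (Fin 2) (Fin 2) (w.1.adicCompletion L)) 1 0 * (toPlace v w (GaloisRepresentations.HeckeCharacter.uniformizer ↥(maximalRealSubfield L) v : v.adicCompletion ↥(maximalRealSubfield L))) ^ (j + 1))) :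
    Nat.card (MulAction.fixedBy (↥(unitaryGroupOfForm (galAdicCompletionMap (L := L) (IsCMField.complexConj L) hw) (placeForm (Matrix.of fun i j : Fin 2 => if i.val + j.val + 1 = 2 then (1 : L) else 0) w.1)) ⧸ ((glInt 2 (w.1.adicCompletion L)).subgroupOf (unitaryGroupOfForm (galAdicCompletionMap (L := L) (IsCMField.complexConj L) hw) (placeForm (Matrix.of fun i j : Fin 2 => if i.val + j.val + 1 = 2 then (1 : L) else 0) w.1)))) γ) = ∑ k ∈ range (j + 1), Nat.card (𝓞 ↥(maximalRealSubfield L) ⧸ v.asIdeal) ^ k := by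
  have hc1 : IsCMField.complexConj L ≠ 1 := IsCMField.complexConj_ne_one L
  have hgU : (((((γ : GL (Fin 2) (w.1.adicCompletion L))) : Matrix (Fin 2) (Fin 2) (w.1.adicCompletion L))).map (galAdicCompletionMap (L := L) (IsCMField.complexConj L) hw))ᵀ * (!![0, 1; 1, 0] : Matrix (Fin 2) (Fin 2) (w.1.adicCompletion L)) * (((γ : GL (Fin 2) (w.1.adicCompletion L))) : Matrix (Fin 2) (Fin 2) (w.1.adicCompletion L)) = !![0, 1; 1, 0] := by
    rw [← placeForm_antidiagTwo_eq_antidiag L v w]; exact mem_unitaryGroupOfForm_iff.1 γ.2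
  have hϖv := Liu2021.LemD1IndexedNonVacuityInertCofinite.valued_toPlace_uniformizer_of_isUnramifiedIn L v hunr w
  have hϖ : IsUniformizingElement (toPlace v w (GaloisRepresentations.HeckeCharacter.uniformizer ↥(maximalRealSubfield L) v : v.adicCompletion ↥(maximalRealSubfield L))) := isUniformizingElement_of_v_eq hϖv
  -- ★ FILE A `natCard_fixedBy_unitary_subtype_eq_ncard` with `A := 0`: the extra predicate is vacuous on both sides
  have h := natCard_fixedBy_unitary_subtype_eq_ncard (galAdicCompletionMap (L := L) (IsCMField.complexConj L) hw) (placeForm (Matrix.of fun i j : Fin 2 => if i.val + j.val + 1 = 2 then (1 : L) else 0) w.1) γ 0 hϖ.ne_zero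
  have e1 : Nat.card {x : MulAction.fixedBy (↥(unitaryGroupOfForm (galAdicCompletionMap (L := L) (IsCMField.complexConj L) hw) (placeForm (Matrix.of fun i j : Fin 2 => if i.val + j.val + 1 = 2 then (1 : L) else 0) w.1)) ⧸ ((glInt 2 (w.1.adicCompletion L)).subgroupOf (unitaryGroupOfForm (galAdicCompletionMap (L := L) (IsCMField.complexConj L) hw) (placeForm (Matrix.of fun i j : Fin 2 => if i.val + j.val + 1 = 2 then (1 : L) else 0) w.1)))) γ //
      ∀ i j, ((((toPlace v w (GaloisRepresentations.HeckeCharacter.uniformizer ↥(maximalRealSubfield L) v : v.adicCompletion ↥(maximalRealSubfield L)))))⁻¹ • (((((x.1.out : ↥(unitaryGroupOfForm (galAdicCompletionMap (L := L) (IsCMField.complexConj L) hw) (placeForm (Matrix.of fun i j : Fin 2 => if i.val + j.val + 1 = 2 then (1 : L) else 0) w.1))) : GL (Fin 2) (w.1.adicCompletion L))⁻¹ : GL (Fin 2) (w.1.adicCompletion L)) : Matrix (Fin 2) (Fin 2) (w.1.adicCompletion L)) *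
          (0 : Matrix (Fin 2) (Fin 2) (w.1.adicCompletion L)) * (((x.1.out : ↥(unitaryGroupOfForm (galAdicCompletionMap (L := L) (IsCMField.complexConj L) hw) (placeForm (Matrix.of fun i j : Fin 2 => if i.val + j.val + 1 = 2 then (1 : L) else 0) w.1))) : GL (Fin 2) (w.1.adicCompletion L)) : Matrix (Fin 2) (Fin 2) (w.1.adicCompletion L)))) i j ∈ 𝒪[(w.1.adicCompletion L)]} =
      Nat.card (MulAction.fixedBy (↥(unitaryGroupOfForm (galAdicCompletionMap (L := L) (IsCMField.complexConj L) hw) (placeForm (Matrix.of fun i j : Fin 2 => if i.val + j.val + 1 = 2 then (1 : L) else 0) w.1)) ⧸ ((glInt 2 (w.1.adicCompletion L)).subgroupOf (unitaryGroupOfForm (galAdicCompletionMap (L := L) (IsCMField.complexConj L) hw) (placeForm (Matrix.of fun i j : Fin 2 => if i.val + j.val + 1 = 2 then (1 : L) else 0) w.1)))) γ) :=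
    Nat.card_congr (Equiv.subtypeUnivEquiv fun x i j => by rw [Matrix.mul_zero, Matrix.zero_mul, smul_zero]; exact zero_mem _)
  rw [← e1, h, ← ncard_selfDualStable_antidiagTwo_eq_sum_of_unitary_affine L v w hw hunr (γ : GL (Fin 2) (w.1.adicCompletion L)) (((γ : GL (Fin 2) (w.1.adicCompletion L))) : Matrix (Fin 2) (Fin 2) (w.1.adicCompletion L)) rfl hgU hirr ha hf hj hk hga']
  congr 1
  ext Λ
  simp only [Set.mem_setOf_eq, map_zero, LinearMap.restrictScalars_zero, Submodule.map_zero, bot_le, and_true]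
  rw [exists_mem_unitary_span_eq_iff_selfDual_of_nonsplit L 2 _ hc1 w hw hunr (antidiagOne_isHermitian L 2)
    (isUnit_placeForm_antidiagOne (E := L) 2 w.1) (unit_placeForm_antidiagOne_mem_glInt (E := L) 2 w.1) Λ]

end Count

/-! ## §5 THE HEAD: the type-(2) edge count at an inert place, Eisenstein centre -/

section Head

variable (L : Type) [Field L] [NumberField L] [IsCMField L] (v : HeightOneSpectrum (𝓞 ↥(maximalRealSubfield L)))
  (w : PlacesOver L v) (hw : IsCMField.complexConj L • w.1 = w.1)

omit [IsCMField L] in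
/-- `Σ_(k ≤ j) q^k = q · Σ_(k < j) q^k + 1`. [cite: Kottwitz1988, §2] -/
private theorem sum_range_succ_pow_eq' (q j : ℕ) : ∑ k ∈ range (j + 1), q ^ k = q * ∑ k ∈ range j, q ^ k + 1 := by
  rw [Finset.sum_range_succ', pow_zero, Finset.mul_sum]
  congr 1
  exact Finset.sum_congr rfl fun k _ => by rw [pow_succ, mul_comm]

set_option maxHeartbeats 800000 in
include hw in
/-- **KOTTWITZ'S EDGE COUNT FOR A TYPE-(2) ELLIPTIC ELEMENT WITH THE EISENSTEIN CENTRE: `#Fix_γ(U_w ⧸ I_w) + 1 = 2·Σ_(k ≤ j) q_v^k`** (any residue characteristic).  At a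
finite place `v` of `L⁺` inert and unramified in the CM field `L` (`w ∣ v`, `c • w = w`), for `γ ∈ U_w = U(σ_w, (Φ₂)_w)` with `χ_γ` WITHOUT ROOT in `L_w` whose Eisenstein datum
`(a, f, e′, j)` satisfies `a ∈ 𝒪_w`, `|f| ≤ |ϖ^(j+1)|`, `|e′| = |ϖ^(2j+1)|`, `(γ − a·1)² = f·(γ − a·1) + e′·1`, `|σ_w(a)·a − 1| < 1` and the weak centring socket
`|γ₁₀·σ_w a + σ_w(γ₁₀)·a| ≤ |γ₁₀·ϖ^(j+1)|` (memo §2(e)∕§3: rows (T)∕(W-odd) `a = tr γ∕2`, `f = 0`, where the socket is the cyclic-frame relation; (W-unit) the Eisenstein centre),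
the `γ`-fixed edges of the tree (`I_w = U_w ∩ Iwahori`) number `2·Σ_(k≤j) q_v^k − 1`: ★ (P5b) `natCard_fixedBy_iwahori_eq_add_mul_of_sub_smul_one_affine` gives `E₂ = V + q·S`;
`V = Σ_(k≤j) q^k` (§3 `natCard_fixedBy_glInt_eq_sum_of_unitary_affine`), `S = Σ_(k<j) q^k` (§3 `natCard_fixedBy_subtype_affine_eq_sum_of_unitary`, the two scalar-reduction
predicates agreeing through `k̄ = ā·1`: ★ `natCard_subtype_valuation_eq_natCard_subtype_inv_smul`), `#{τt = −t} = q` (★ `natCard_antifixed_residueField_eq`), and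
`Σ_(k≤j) q^k = q·Σ_(k<j) q^k + 1`.  With `V_K = V_{K′} = Σ_(k≤j) q^k` this is the Euler characteristic `V_K + V_{K′} − E₂ = 1` of the fixed subtree — the type-(2)
elliptic row of (R2) [Kottwitz1988 §2 Thm 2], at every residue characteristic.  Twin of ★ `natCard_fixedBy_iwahori_add_one_eq_two_mul_sum_of_not_exists_isRoot`
(`|2|_w = 1`, centre `tr∕2`, radius `N`). [cite: Kottwitz1988, §2 Theorem 2] [cite: Rogawski1990, §12.6 p. 174] -/
theorem natCard_fixedBy_iwahori_add_one_eq_two_mul_sum_of_affine (hunr : Algebra.IsUnramifiedIn (𝓞 L) v.asIdeal) (γ : ↥(unitaryGroupOfForm (galAdicCompletionMap (L := L) (IsCMField.complexConj L) hw) (placeForm (Matrix.of fun i j : Fin 2 => if i.val + j.val + 1 = 2 then (1 : L) else 0) w.1)))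
    (hirr : ¬ ∃ x : (w.1.adicCompletion L), ((((γ : GL (Fin 2) (w.1.adicCompletion L))) : Matrix (Fin 2) (Fin 2) (w.1.adicCompletion L)).charpoly).IsRoot x)
    {a f e' : (w.1.adicCompletion L)} (ha : a ∈ 𝒪[(w.1.adicCompletion L)]) {j : ℕ}
    (hf : valuation (w.1.adicCompletion L) f ≤ valuation (w.1.adicCompletion L) ((toPlace v w (GaloisRepresentations.HeckeCharacter.uniformizer ↥(maximalRealSubfield L) v : v.adicCompletion ↥(maximalRealSubfield L))) ^ (j + 1)))
    (hj : valuation (w.1.adicCompletion L) e' = valuation (w.1.adicCompletion L) ((toPlace v w (GaloisRepresentations.HeckeCharacter.uniformizer ↥(maximalRealSubfield L) v : v.adicCompletion ↥(maximalRealSubfield L))) ^ (2 * j + 1)))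
    (hk : ((((γ : GL (Fin 2) (w.1.adicCompletion L))) : Matrix (Fin 2) (Fin 2) (w.1.adicCompletion L)) - a • (1 : Matrix (Fin 2) (Fin 2) (w.1.adicCompletion L))) * ((((γ : GL (Fin 2) (w.1.adicCompletion L))) : Matrix (Fin 2) (Fin 2) (w.1.adicCompletion L)) - a • (1 : Matrix (Fin 2) (Fin 2) (w.1.adicCompletion L))) = f • ((((γ : GL (Fin 2) (w.1.adicCompletion L))) : Matrix (Fin 2) (Fin 2) (w.1.adicCompletion L)) - a • (1 : Matrix (Fin 2) (Fin 2) (w.1.adicCompletion L))) + e' • (1 : Matrix (Fin 2) (Fin 2) (w.1.adicCompletion L)))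
    (haa : valuation (w.1.adicCompletion L) ((galAdicCompletionMap (L := L) (IsCMField.complexConj L) hw) a * a - 1) < 1)
    (hga' : valuation (w.1.adicCompletion L) ((((γ : GL (Fin 2) (w.1.adicCompletion L))) : Matrix (Fin 2) (Fin 2) (w.1.adicCompletion L)) 1 0 * (galAdicCompletionMap (L := L) (IsCMField.complexConj L) hw) a + (galAdicCompletionMap (L := L) (IsCMField.complexConj L) hw) ((((γ : GL (Fin 2) (w.1.adicCompletion L))) : Matrix (Fin 2) (Fin 2) (w.1.adicCompletion L)) 1 0) * a) ≤ valuation (w.1.adicCompletion L) ((((γ : GL (Fin 2) (w.1.adicCompletion L))) : Matrix (Fin 2) (Fin 2) (w.1.adicCompletion L)) 1 0 * (toPlace v w (GaloisRepresentations.HeckeCharacter.uniformizer ↥(maximalRealSubfield L) v : v.adicCompletion ↥(maximalRealSubfield L))) ^ (j + 1))) :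
    Nat.card (MulAction.fixedBy (↥(unitaryGroupOfForm (galAdicCompletionMap (L := L) (IsCMField.complexConj L) hw) (placeForm (Matrix.of fun i j : Fin 2 => if i.val + j.val + 1 = 2 then (1 : L) else 0) w.1)) ⧸ ((iwahoriGL 2 (w.1.adicCompletion L)).subgroupOf (unitaryGroupOfForm (galAdicCompletionMap (L := L) (IsCMField.complexConj L) hw) (placeForm (Matrix.of fun i j : Fin 2 => if i.val + j.val + 1 = 2 then (1 : L) else 0) w.1)))) γ) + 1 = 2 * ∑ k ∈ range (j + 1), Nat.card (𝓞 ↥(maximalRealSubfield L) ⧸ v.asIdeal) ^ k := by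
  classical
  -- the place: uniformizer, DVR, the integral involution `σO`, its reduction `σk`, `|𝓀| = q²`, the moved integer `a₀` (verbatim from ★ B2)
  have hc1 : IsCMField.complexConj L ≠ 1 := IsCMField.complexConj_ne_one L
  have hϖv := Liu2021.LemD1IndexedNonVacuityInertCofinite.valued_toPlace_uniformizer_of_isUnramifiedIn L v hunr w
  have hϖ : IsUniformizingElement (toPlace v w (GaloisRepresentations.HeckeCharacter.uniformizer ↥(maximalRealSubfield L) v : v.adicCompletion ↥(maximalRealSubfield L))) := isUniformizingElement_of_v_eq hϖv
  haveI : IsDiscreteValuationRing 𝒪[(w.1.adicCompletion L)] := isDiscreteValuationRing_integer_of_compatible hϖv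
  have hσO : ∀ x : 𝒪[(w.1.adicCompletion L)], (galAdicCompletionMap (L := L) (IsCMField.complexConj L) hw) x ∈ 𝒪[(w.1.adicCompletion L)] := mem_integer_galAdicCompletionMap (IsCMField.complexConj L) v w hw
  let σO : 𝒪[(w.1.adicCompletion L)] →+* 𝒪[(w.1.adicCompletion L)] := (((galAdicCompletionMap (L := L) (IsCMField.complexConj L) hw)).comp (𝒪[(w.1.adicCompletion L)]).subtype).codRestrict 𝒪[(w.1.adicCompletion L)] fun x => hσO x
  have hσO' : ∀ x : 𝒪[(w.1.adicCompletion L)], ((σO x : 𝒪[(w.1.adicCompletion L)]) : (w.1.adicCompletion L)) = (galAdicCompletionMap (L := L) (IsCMField.complexConj L) hw) x := fun _ => rfl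
  have hσσ : ∀ x, σO (σO x) = x := fun x =>
    Subtype.ext (galAdicCompletionMap_galAdicCompletionMap_of_smul_eq (IsCMField.complexConj L) w hc1 hw (x : (w.1.adicCompletion L)))
  obtain ⟨σk, hσk⟩ := exists_residueField_ringHom_galAdicCompletionMap (IsCMField.complexConj L) v w hw
  have hτ : ∀ x : 𝒪[(w.1.adicCompletion L)], IsLocalRing.residue 𝒪[(w.1.adicCompletion L)] (σO x) = σk (IsLocalRing.residue 𝒪[(w.1.adicCompletion L)] x) := fun x => hσk x
  have hq : Nat.card 𝓀[(w.1.adicCompletion L)] = Nat.card (𝓞 ↥(maximalRealSubfield L) ⧸ v.asIdeal) ^ 2 := natCard_residueField_eq_sq_of_inert (IsCMField.complexConj L) v hc1 hunr w hw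
  letI : Fintype 𝓀[(w.1.adicCompletion L)] := Fintype.ofFinite _
  have hq' : Fintype.card 𝓀[(w.1.adicCompletion L)] = Nat.card (𝓞 ↥(maximalRealSubfield L) ⧸ v.asIdeal) ^ 2 := by rw [← Nat.card_eq_fintype_card, hq]
  obtain ⟨a₀, ha₀⟩ := LocalFields.UnramifiedQuadraticNorm.exists_isUnit_map_sub_of_residueHom_ne (galAdicCompletionMap (L := L) (IsCMField.complexConj L) hw) hσO σk hσk
    (Literature.LinearAlgebra.Matrix.exists_frob_ne hq' σk (residueHom_galAdicCompletionMap_eq_pow (IsCMField.complexConj L) v hc1 hunr w hw σk hσO hσk))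
  have ha₀' : IsUnit (σO a₀ - a₀) := ha₀
  have hs : Nat.card {t : 𝓀[(w.1.adicCompletion L)] // σk t = -t} = Nat.card (𝓞 ↥(maximalRealSubfield L) ⧸ v.asIdeal) := natCard_antifixed_residueField_eq σO hσσ ha₀' σk hτ hq
  -- the package for ★ (P5b): `f, e′ ∈ 𝒪`, `|f| < 1`, `|e′| < 1` from the sharp binders
  have hϖ1 : valuation (w.1.adicCompletion L) ((toPlace v w (GaloisRepresentations.HeckeCharacter.uniformizer ↥(maximalRealSubfield L) v : v.adicCompletion ↥(maximalRealSubfield L))) : (w.1.adicCompletion L)) < 1 := by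
    rw [← v_lt_one_iff_valuation_lt_one, hϖv, ← WithZero.exp_zero, WithZero.exp_lt_exp]; omega
  have hpow : ∀ n : ℕ, valuation (w.1.adicCompletion L) (((toPlace v w (GaloisRepresentations.HeckeCharacter.uniformizer ↥(maximalRealSubfield L) v : v.adicCompletion ↥(maximalRealSubfield L))) : (w.1.adicCompletion L)) ^ (n + 1)) < 1 := fun n => by
    rw [map_pow]; exact pow_lt_one₀ zero_le hϖ1 (Nat.succ_ne_zero n)
  have hf1 : valuation (w.1.adicCompletion L) f < 1 := lt_of_le_of_lt hf (hpow j)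
  have he1 : valuation (w.1.adicCompletion L) e' < 1 := by rw [hj]; exact hpow (2 * j)
  have hfO : f ∈ 𝒪[(w.1.adicCompletion L)] := (Valuation.mem_integer_iff _ _).2 hf1.le
  have he'O : e' ∈ 𝒪[(w.1.adicCompletion L)] := (Valuation.mem_integer_iff _ _).2 he1.le
  -- the vertex count `V = Σ_(k ≤ j) q^k` and finiteness of the fixed vertices
  have hV := natCard_fixedBy_glInt_eq_sum_of_unitary_affine L v w hw hunr γ hirr ha hf hj hk hga'
  have hVpos : ∑ k ∈ range (j + 1), Nat.card (𝓞 ↥(maximalRealSubfield L) ⧸ v.asIdeal) ^ k ≠ 0 := by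
    rw [Finset.sum_range_succ', pow_zero]; exact Nat.succ_ne_zero _
  haveI : Finite (MulAction.fixedBy (↥(unitaryGroupOfForm (galAdicCompletionMap (L := L) (IsCMField.complexConj L) hw) (placeForm (Matrix.of fun i j : Fin 2 => if i.val + j.val + 1 = 2 then (1 : L) else 0) w.1)) ⧸ ((glInt 2 (w.1.adicCompletion L)).subgroupOf (unitaryGroupOfForm (galAdicCompletionMap (L := L) (IsCMField.complexConj L) hw) (placeForm (Matrix.of fun i j : Fin 2 => if i.val + j.val + 1 = 2 then (1 : L) else 0) w.1)))) γ) := Nat.finite_of_card_ne_zero (by rw [hV]; exact hVpos)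
  -- §4″: `E₂ = V + q·S` with the Eisenstein centre (★ (P5b) B1′)
  have hE := natCard_fixedBy_iwahori_eq_add_mul_of_sub_smul_one_affine (galAdicCompletionMap (L := L) (IsCMField.complexConj L) hw) σO hσO' hσσ ha₀' σk hτ
    (placeForm_antidiagTwo_eq_antidiag L v w) γ ha hfO he'O hf1 he1 hk haa
  -- `S = Σ_(k < j) q^k`: the valuation predicate of §4″ is the `ϖ`-predicate of §3 (both say `k̄_x = ā·1`, ★ B1 bridge)
  have hS := (natCard_subtype_valuation_eq_natCard_subtype_inv_smul (galAdicCompletionMap (L := L) (IsCMField.complexConj L) hw) hϖ γ ha).trans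
    (natCard_fixedBy_subtype_affine_eq_sum_of_unitary L v w hw hunr γ hirr ha hf hj hk hga')
  -- `E₂ + 1 = V + q·S + 1 = 2V` (`V = q·S + 1`)
  have hPS := sum_range_succ_pow_eq' (Nat.card (𝓞 ↥(maximalRealSubfield L) ⧸ v.asIdeal)) j
  -- (term-mode substitution of the three counts: no `rw` next to the place-level subtype terms)
  have h3 := congr (congrArg HAdd.hAdd hV) (congr (congrArg HMul.hMul hs) hS)
  omega

end Head

end Literature.NumberTheory.Automorphic.UnitaryGroup

end
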